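import Literature.MathematicalPhysics.QuantumFieldTheory.Balaban1983to89.B9Eq326DeltaAHQKLettersTower
import Literature.MathematicalPhysics.QuantumFieldTheory.Balaban1983to89.B9Eq3126H1BlockDecayTower
import Literature.MathematicalPhysics.QuantumFieldTheory.Balaban1983to89.B9Eq315QAdjointFarField

/-!
# `Balaban1983to89.B9Eq3126H1BlockDecayTowerClosed` — T. Bałaban, *Propagators for lattice gauge theories in a background field*, Commun. Math. Phys. **99**
# (1985) 389–434 [Balaban1985BackgroundPropagators] (3.26) p. 395, (3.15)–(3.19) p. 393, (3.49) p. 399 («the constants … independent of the field configuration»),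
# (3.126) p. 420, Thm 3.11 p. 416 with [Balaban1985Variational] (45) p. 285, (103) p. 293: **THE `L²` DECAY ROW OF `H₁,k(U)` AT EVERY HEIGHT WITH EVERY
# CONJUGATION ∕ SIZE ∕ FAR-FIELD LETTER DISCHARGED at `Q_k(U) := QkW`** — ne9-leaf-03's (H1DT) `B9Eq3126H1BlockDecayTower.norm_block_H1k_le` composed BY NAME
# with gen 94's `B9Eq326DeltaAHQKLettersTower.hQK_of_chain_tower`, the tower `C_P` letter, g92's `p_K` floor, ne9-leaf-01's (N51) §3
# `norm_block_adjoint_QkW_le_of_geometric_window` (`C_Q†`) and `B9Eq316PenaltyPointwiseBoundHeightFree.norm_QkW_le_of_geometric_window` (`C_Q`, height-free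
# on a geometric bond-window profile `ε_j ≤ ε_s ϱ^j`), «`Q_k` onto» by `B9Eq326OperatorTower.QkW_surjective`.  Displayed: `γ` (Thm 3.11 for `Δ_{a,k}`) + `hpos`,
# `μ₁` ([B11] (45)), the `G′_k` side, the MODEL letters (with the geometric profile) and CLOSED windows

statement-level skeleton of published theorems with citation tags; proofs where landed; nothing here is a claim about the Yang–Mills mass gap

CITATION HEADER (lean-in-tree rule).  Audit cell `pub-balaban`, sub-cell `t4`, BINDER row NE9; filed by the NE9 BINDER-row OWNER lineage
`b2b-balaban-t4-ne9-p1` (gen 94).  Imports gen 94's `B9Eq326DeltaAHQKLettersTower`, ne9-leaf-03's (H1DT) `B9Eq3126H1BlockDecayTower`, ne9-leaf-01's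
`B9Eq315QAdjointFarField` (with `B9Eq316PenaltyPointwiseBoundHeightFree` through it).  Sources READ first-hand (`paper:balaban1985-cmp99-background-propagators`):
p. 395 (3.26), p. 393 (3.15)–(3.19), p. 399 (3.49), p. 420 (3.126), p. 416 Thm 3.11; [Balaban1985Variational] p. 285 (45), p. 293 (103).  Print's decay proof is
the random walk of Sect. C; the cell's road is Combes–Thomas; every constant below is the cell's; `μ₁` is [B11] (45) DISPLAYED.

WHAT IS PROVED (sorry-free; proof lane — no `def`; [folklore] composition BY NAME).
* **`norm_block_H1k_le_closed`** — at every height `n`, for `Δ_{a,k}(U)` at `Q_k(U) := QkW` in the per-level regime `50(d+1)α_jL^d ≤ ½`, `0 ≤ α_j`, the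
  geometric bond-window profile `ε_j ≤ ε_s ϱ^j` (`0 ≤ ϱ < 1`), the MODEL letters, `γ`-coercivity + `hpos` (`γ ≤ 1`), `Q_kG₁,kQ_k† ≥ μ₁`, the `G′_k`-side letters
  and the CLOSED windows of `B9Eq326DeltaAHQKLettersTower` plus (H1DT)'s (`β ≤ 1`, `0 ≤ β_K`, `small` at `C_P := √(M∕√κ₁)`, `small2` at `C_Q := M_φ′M_φ√(c₁∕(c₀
  (L^{n+1})^d))·exp(√(L^d)√(2d)·102(d+1)²L·ε_s∕(1−ϱ))`): for every `0 ≤ r′ < r`,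
  `‖P_{y₁} ∘ H₁,k(U) ∘ r_{y₀}‖ ≤ (4∕γ)e^{r}·(C_Q·e^{r})·(2∕μ₁)e^{r}·K_d(r − r′)²·e^{−r′·d_m(y₀,y₁)}`.
HONEST SCOPE.  Composition; `γ`, `μ₁`, `hpos`, `γ′`, `a′`, `hpos′`, `κ₁`, `M` DISPLAYED; the tower `dQ` window carries gen 93's height-dependent product difference;
nothing of [B9] Thm 3.1∕3.3∕3.11 or [B11] (45) asserted, valued or discharged; «NE9 ⇐ the named binders»; NE9 NOT PRINTED ∕ NOT PROVED; row WALLED ON A MODEL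
(O-NE9-1; #5 UNRULED); spine PROVED 0∕9; rung (B)+1 on a finite T⁴ — NOT infinite volume, NOT mass gap, NOT BetaPertH, NOT Clay.  HONEST DEPENDENCY: continuum
YM on T⁴ ⇐ BetaPertH ∧ nine spine estimates (0/9 proved); BetaPertH ⇐ (D1) ∧ (D4) ∧ CAP+tail.  NEW file; nothing modified.  Net new unproved facts: 0.
-/

noncomputable section

set_option autoImplicit false

open scoped InnerProductSpace ComplexConjugate BigOperators
open NormedSpace

namespace Literature.MathematicalPhysics.QuantumFieldTheory.Balaban1983to89.B9Eq3126H1BlockDecayTowerClosed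

open B4Sect5Torus (TSite tdist)
open B4Sect5Proof (latticeConst)
open B9SectCLatticeCarrier (Bond DirPair bpos btgt)
open B9Eq311L2Pairing (WL2)
open B9Eq319QprimeTorus (fineP blockCoord)
open B9Eq315QTower (towerP UlevOf)
open B9Eq315QTorus (perCfg cornerSite)
open B7Prop1Explicit (U1 Wcx boxVec)
open B9Eq316TowerFlatIsOneStep (siteCast towerP_eq_fineP_pow)
open B11Eq103H1Complex (SiteL2K BondL2K covDerivL2K covDivL2K)
open B9Eq310DeltaPrime (reHol imHol)
open B9Eq310HessianOperator (adTransportW curvOp)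
open B9Eq326OperatorTower (laplaceAk RofUk G1k H1k QkW QprimeTowerW QkW_surjective)
open B9Eq324DeltaPrimeATower (laplacePrimeAk GpOfUk)
open B9Eq3126H1BlockDecayTower (norm_block_H1k_le)
open B9Eq326DeltaAHQKLettersTower (hQK_of_chain_tower)
open B9Eq369CurvFormL2 (re_inner_curvOp_self_ge)
open B9Eq315QAdjointFarField (norm_block_adjoint_QkW_le_of_geometric_window)
open B9Eq316PenaltyPointwiseBoundHeightFree (norm_QkW_le_of_geometric_window)

variable {d : ℕ} (L : ℕ) [NeZero L] (m : Fin d → ℕ) [∀ i, NeZero (m i)] (n : ℕ)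
  {𝔸 : Type*} [NormedRing 𝔸] [StarRing 𝔸] [NormedAlgebra ℂ 𝔸] [StarModule ℂ 𝔸] [CompleteSpace 𝔸] [NormOneClass 𝔸]
  {W : Type*} [NormedAddCommGroup W] [InnerProductSpace ℂ W] [FiniteDimensional ℂ W] (φ : W ≃ₗ[ℂ] 𝔸) {Mφ Mφ' : ℝ}
  (hφ : ∀ w, ‖φ w‖ ≤ Mφ * ‖w‖) (hφ' : ∀ X, ‖φ.symm X‖ ≤ Mφ' * ‖X‖) (hMφ : 0 ≤ Mφ) (hMφ' : 0 ≤ Mφ') (hstar : ∀ X : 𝔸, ‖star X‖ ≤ ‖X‖)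
  {c₀ : ℝ} [Fact (0 < c₀)] {c₁ : ℝ} [Fact (0 < c₁)] {η : ℝ} (hη : 0 < η) (hηL : η * (L : ℝ) ^ (n + 1) = 1)
  (U : Bond d (towerP L m (n + 1)) → 𝔸ˣ) (hU : ∀ b, U b ∈ U1 𝔸)
  (hRS : ∀ (b : Bond d (towerP L m (n + 1))) (v u : W), ⟪adTransportW φ U b v, u⟫_ℂ = ⟪v, adTransportW φ (fun b => (U b)⁻¹) b u⟫_ℂ)
  (τ : 𝔸 →ₗ[ℂ] ℂ) {Mτ : ℝ} (hτ : ∀ X Y : 𝔸, ‖τ (X * Y)‖ ≤ Mτ * ‖X‖ * ‖Y‖) (hMτ : 0 ≤ Mτ)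
  (hL : 1 ≤ L) (hm : ∀ i, 1 ≤ m i) (α : ℕ → ℝ) (hα0 : ∀ j, 0 ≤ α j) (hα1 : ∀ j, α j ≤ 1 / 64)
  (hαL : ∀ j, 50 * (d + 1) * α j * (L : ℝ) ^ d ≤ 1 / 2)
  (hU1 : ∀ (j : ℕ) (x : B7Prop1Explicit.Site d) (k : Fin d), perCfg (towerP L m (j + 1)) (UlevOf L m (n + 1) U j) x k ∈ U1 𝔸)
  (hreg : ∀ (j : ℕ) (y : TSite d (towerP L m j)) (k : Fin d) (ρ' : Fin d → Fin L),
    ‖((Wcx L (perCfg (towerP L m (j + 1)) (UlevOf L m (n + 1) U j)) (cornerSite L y) k (boxVec L ρ') : 𝔸ˣ) : 𝔸) - 1‖ ≤ α j)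
  (εU : ℕ → ℝ) (hεU : ∀ j, 0 ≤ εU j)
  (hUε : ∀ (j : ℕ) (b : Bond d (towerP L m (j + 1))), ‖(UlevOf L m (n + 1) U j b : 𝔸) - 1‖ ≤ εU j)
  {ϱ εs : ℝ} (hϱ0 : 0 ≤ ϱ) (hϱ1 : ϱ < 1) (hεs : 0 ≤ εs) (hεg : ∀ j < n + 1, εU j ≤ εs * ϱ ^ j)
  {δ : ℝ} (hδ : 0 ≤ δ)
  (hRe : ∀ p : B9SectCLatticeCarrier.Plaq d (towerP L m (n + 1)), ‖reHol U p - 1‖ ≤ δ)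
  (hIm : ∀ p : B9SectCLatticeCarrier.Plaq d (towerP L m (n + 1)), ‖imHol U p‖ ≤ δ)
  {a' : ℝ} (ha' : 0 ≤ a')
  (hpos' : ∀ x : SiteL2K ℂ d (towerP L m (n + 1)) c₀ W, x ≠ 0 → 0 < RCLike.re ⟪x, laplacePrimeAk L m n φ η U a' (c₁ := c₁) x⟫_ℂ)
  {γ' κ₁ M : ℝ} (hγ' : 0 < γ') (hγ'1 : γ' ≤ 1) (hκ₁ : 0 < κ₁) (hM : 0 ≤ M)
  (coercive : ∀ f : SiteL2K ℂ d (towerP L m (n + 1)) c₀ W, γ' * ‖f‖ ^ 2 ≤ ‖(covDerivL2K ℂ c₀ ((η : ℂ))⁻¹ (adTransportW φ U)) f‖ ^ 2 +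
    a' * ‖((WL2.linearEquiv ℂ ℂ (fun _ : TSite d m => c₁)).symm.toLinearMap ∘ₗ QprimeTowerW L m n φ U (c₀ := c₀)) f‖ ^ 2)
  (hκ : ∀ ψ : SiteL2K ℂ d m c₁ W, κ₁ * ‖ψ‖ ^ 2 ≤ RCLike.re ⟪ψ,
    (((WL2.linearEquiv ℂ ℂ (fun _ : TSite d m => c₁)).symm.toLinearMap ∘ₗ QprimeTowerW L m n φ U (c₀ := c₀)) ∘ₗ
      GpOfUk L m n φ η U a' (c₁ := c₁) hpos' ∘ₗ GpOfUk L m n φ η U a' (c₁ := c₁) hpos' ∘ₗ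
      LinearMap.adjoint ((WL2.linearEquiv ℂ ℂ (fun _ : TSite d m => c₁)).symm.toLinearMap ∘ₗ QprimeTowerW L m n φ U (c₀ := c₀))) ψ⟫_ℂ)
  (hMQ : ∀ s : SiteL2K ℂ d (towerP L m (n + 1)) c₀ W,
    ‖((WL2.linearEquiv ℂ ℂ (fun _ : TSite d m => c₁)).symm.toLinearMap ∘ₗ QprimeTowerW L m n φ U (c₀ := c₀)) s‖ ≤ M * ‖s‖)
  {r ℓ ℓ' β βK β' ρ : ℝ} (hr : 0 ≤ r) (hℓ : 1 ≤ ℓ) (hℓ' : 1 ≤ ℓ') (hβ'0 : 0 ≤ β') (hβ'1 : β' ≤ 1)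
  (hwin : r * ℓ * η ≤ 1) (hwin0 : r * (3 * ℓ' + (L : ℝ) ^ (n + 1) * (ℓ * η)) ≤ 1) (hwin1 : r * (2 * d * (L : ℝ) ^ n * (ℓ * η)) ≤ 1)
  (hwin' : r * ℓ' ≤ 1)
  (hβT : Mφ' * Mφ * Real.sqrt (c₁ / (c₀ * ((L : ℝ) ^ (n + 1)) ^ d)) *
    ((∏ j ∈ Finset.range (n + 1), (1 + Real.sqrt ((L : ℝ) ^ d) * (Real.sqrt (2 * d) * (102 * (d + 1) ^ 2 * L * εU j) +
        2 * (r * (if j = 0 then 3 * ℓ' + (L : ℝ) ^ (n + 1) * (ℓ * η) else 2 * d * (L : ℝ) ^ (n + 1 - j) * (ℓ * η))) *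
          Real.sqrt (2 * (2 * d * (102 * (d + 1) ^ 2 * L * εU j) ^ 2 + ((L : ℝ) ^ d)⁻¹))))) -
      ∏ j ∈ Finset.range (n + 1), (1 + Real.sqrt ((L : ℝ) ^ d) * (Real.sqrt (2 * d) * (102 * (d + 1) ^ 2 * L * εU j)))) ≤ β)
  (hβK : 8 * (r * (ℓ * η)) * (768 * Fintype.card (DirPair d) * Mτ * Mφ ^ 2 * (‖((η : ℂ)) ^ d‖ / c₀) * ‖((η : ℂ))⁻¹‖ ^ 2 * δ) ≤ βK)
  (hβ'D : 2 * r * ℓ * (Mφ * Mφ') * Real.sqrt d ≤ β') (hβ'Q : 2 * r * ℓ' * M ≤ β')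
  (small' : 3 * (1 + a') * β' ^ 2 ≤ γ' / 4) (hwinκ : 12 * (β' * (4 / γ' + M * ((4 / γ') ^ 2 * (3 + a' * (2 * M + 1))))) ≤ Real.sqrt κ₁)
  (hρ : (6 * (β' * (4 / γ' + M * ((4 / γ') ^ 2 * (3 + a' * (2 * M + 1))))) + 9 * (β' * (4 / γ' + M * ((4 / γ') ^ 2 * (3 + a' * (2 * M + 1)))))) /
    Real.sqrt κ₁ ≤ ρ)

include hφ hφ' hMφ hMφ' hstar hη hηL hU hRS hτ hMτ hm hα0 hεU hUε hϱ0 hϱ1 hεs hεg hδ hRe hIm ha' hγ' hγ'1 hκ₁ hM coercive hκ hMQ hr hℓ hℓ' hβ'0 hβ'1 hwin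
  hwin0 hwin1 hwin' hβT hβK hβ'D hβ'Q small' hwinκ hρ in
/-- **THE `L²` DECAY ROW OF `H₁,k(U)` AT EVERY HEIGHT, EVERY CONJUGATION ∕ SIZE ∕ FAR-FIELD LETTER DISCHARGED**: (H1DT) `norm_block_H1k_le` with
`hQK := hQK_of_chain_tower`, `hP :=` the tower `C_P` letter (`C_P = √(M∕√κ₁)`), `hKre :=` g92, `hQ := norm_QkW_le_of_geometric_window`
(`C_Q = M_φ′M_φ√(c₁∕(c₀(L^{n+1})^d))·exp(√(L^d)√(2d)·102(d+1)²L·ε_s∕(1−ϱ))`), `hQs := QkW_surjective`, `hQa := norm_block_adjoint_QkW_le_of_geometric_window`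
(`C_Q† = C_Q·e^{r}`): for every `0 ≤ r′ < r`, `‖P_{y₁} ∘ H₁,k(U) ∘ r_{y₀}‖ ≤ (4∕γ)e^{r}·(C_Q·e^{r})·(2∕μ₁)e^{r}·K_d(r − r′)²·e^{−r′·d_m(y₀,y₁)}` given ONLY
`γ` + `hpos`, `μ₁`, the `G′_k`-side letters, the MODEL letters and CLOSED windows. [cite: Balaban1985BackgroundPropagators, (3.26) p.395, (3.15)–(3.19) p.393,
(3.49) p.399, (3.126) p.420, Thm 3.11 p.416; Balaban1985Variational, (45) p.285, (103) p.293] -/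
theorem norm_block_H1k_le_closed (a : ℝ) (ha : 0 ≤ a)
    (hpos : ∀ x : BondL2K ℂ d (towerP L m (n + 1)) c₀ W, x ≠ 0 →
      0 < RCLike.re ⟪x, laplaceAk L m n φ η U hL α hα1 hU1 hreg τ (c₀ := c₀) (c₁ := c₁) a x⟫_ℂ)
    {γ μ₁ : ℝ} (hγ : 0 < γ) (hγ1 : γ ≤ 1) (hβ : 0 ≤ β) (hβ1 : β ≤ 1) (hβK0 : 0 ≤ βK) (hρ0 : 0 ≤ ρ) (hρ8 : ρ ≤ 1 / 8) (hμ₁ : 0 < μ₁)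
    (hcoer : ∀ f : BondL2K ℂ d (towerP L m (n + 1)) c₀ W, γ * ‖f‖ ^ 2 ≤
      RCLike.re ⟪f, laplaceAk L m n φ η U hL α hα1 hU1 hreg τ (c₀ := c₀) (c₁ := c₁) a f⟫_ℂ)
    (hX1 : ∀ g : BondL2K ℂ d m c₁ W, μ₁ * ‖g‖ ^ 2 ≤
      RCLike.re ⟪g, (QkW L m n φ U hL α hα1 hU1 hreg (c₀ := c₀) (c₁ := c₁))
        (G1k L m n φ η U hL α hα1 hU1 hreg τ (c₀ := c₀) (c₁ := c₁) hpos
          (LinearMap.adjoint (QkW L m n φ U hL α hα1 hU1 hreg (c₀ := c₀) (c₁ := c₁)) g))⟫_ℂ)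
    (hβCC : 4 * r * ℓ * (Mφ * Mφ') * (d * Real.sqrt d) ≤ β) (hβC : 4 * r * ℓ * (Mφ * Mφ') * d ≤ β)
    (hβD : 2 * r * ℓ * (Mφ * Mφ') * Real.sqrt d ≤ β)
    (small : (768 * Fintype.card (DirPair d) * Mτ * Mφ ^ 2 * (‖((η : ℂ)) ^ d‖ / c₀) * ‖((η : ℂ))⁻¹‖ ^ 2 * δ) / 2 + (21 + 3 * a) * β ^ 2 +
      4 * β * Real.sqrt (M / Real.sqrt κ₁) + 2 * ρ * (Real.sqrt (M / Real.sqrt κ₁)) ^ 2 + βK ≤ γ / 4)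
    (small2 : β * (4 / γ) * (2 * (Mφ' * Mφ * Real.sqrt (c₁ / (c₀ * ((L : ℝ) ^ (n + 1)) ^ d)) *
        Real.exp (Real.sqrt ((L : ℝ) ^ d) * (Real.sqrt (2 * d) * (102 * (d + 1) ^ 2 * L)) * (εs / (1 - ϱ)))) + 1) +
      (Mφ' * Mφ * Real.sqrt (c₁ / (c₀ * ((L : ℝ) ^ (n + 1)) ^ d)) *
          Real.exp (Real.sqrt ((L : ℝ) ^ d) * (Real.sqrt (2 * d) * (102 * (d + 1) ^ 2 * L)) * (εs / (1 - ϱ)))) *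
        ((Mφ' * Mφ * Real.sqrt (c₁ / (c₀ * ((L : ℝ) ^ (n + 1)) ^ d)) *
          Real.exp (Real.sqrt ((L : ℝ) ^ d) * (Real.sqrt (2 * d) * (102 * (d + 1) ^ 2 * L)) * (εs / (1 - ϱ)))) + 1) *
        (β * (4 / γ * (2 * (8 / γ) + (8 / γ + 4 / γ) + 2 * ((8 / γ + 4 / γ * Real.sqrt (M / Real.sqrt κ₁)) + 4 / γ) +
          a * (Mφ' * Mφ * Real.sqrt (c₁ / (c₀ * ((L : ℝ) ^ (n + 1)) ^ d)) *
            Real.exp (Real.sqrt ((L : ℝ) ^ d) * (Real.sqrt (2 * d) * (102 * (d + 1) ^ 2 * L)) * (εs / (1 - ϱ)))) * (4 / γ) +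
          a * ((Mφ' * Mφ * Real.sqrt (c₁ / (c₀ * ((L : ℝ) ^ (n + 1)) ^ d)) *
            Real.exp (Real.sqrt ((L : ℝ) ^ d) * (Real.sqrt (2 * d) * (102 * (d + 1) ^ 2 * L)) * (εs / (1 - ϱ)))) + 1) * (4 / γ))) +
          ρ * ((8 / γ + 4 / γ * Real.sqrt (M / Real.sqrt κ₁)) * ((8 / γ + 4 / γ * Real.sqrt (M / Real.sqrt κ₁)) + 4 / γ)) +
          βK * (4 / γ) ^ 2) ≤ μ₁ / 2)
    (PB : TSite d m → BondL2K ℂ d (towerP L m (n + 1)) c₀ W →L[ℂ] BondL2K ℂ d (towerP L m (n + 1)) c₀ W)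
    (hPB : ∀ (y : TSite d m) (f : BondL2K ℂ d (towerP L m (n + 1)) c₀ W) (b : Bond d (towerP L m (n + 1))),
      WL2.equiv ℂ (fun _ : Bond d (towerP L m (n + 1)) => c₀) W (PB y f) b =
        if blockCoord (L ^ (n + 1)) m (siteCast (towerP_eq_fineP_pow L m (n + 1)) (bpos b)) = y then
          WL2.equiv ℂ (fun _ : Bond d (towerP L m (n + 1)) => c₀) W f b else 0)
    {rF : TSite d m → BondL2K ℂ d m c₁ W →L[ℂ] BondL2K ℂ d m c₁ W}
    (hrF : ∀ (y : TSite d m) (g : BondL2K ℂ d m c₁ W) (b' : Bond d m),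
      WL2.equiv ℂ (fun _ : Bond d m => c₁) W (rF y g) b' = if bpos b' = y then WL2.equiv ℂ (fun _ : Bond d m => c₁) W g b' else 0)
    {r' : ℝ} (hr' : 0 ≤ r') (hr'r : r' < r) (y₀ y₁ : TSite d m) :
    ‖PB y₁ ∘L LinearMap.toContinuousLinearMap (H1k L m n φ η U hL α hα1 hU1 hreg τ (c₀ := c₀) (c₁ := c₁) hαL hpos) ∘L rF y₀‖ ≤
      (4 / γ * Real.exp r) *
          (Mφ' * Mφ * Real.sqrt (c₁ / (c₀ * ((L : ℝ) ^ (n + 1)) ^ d)) *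
              Real.exp (Real.sqrt ((L : ℝ) ^ d) * (Real.sqrt (2 * d) * (102 * (d + 1) ^ 2 * L)) * (εs / (1 - ϱ))) * Real.exp (r * 1)) *
        (2 / μ₁ * Real.exp r) * latticeConst d (r - r') ^ 2 * Real.exp (-(r' * tdist m y₀ y₁)) := by
  have hKre : ∀ f : BondL2K ℂ d (towerP L m (n + 1)) c₀ W,
      -((768 * Fintype.card (DirPair d) * Mτ * Mφ ^ 2 * (‖((η : ℂ)) ^ d‖ / c₀) * ‖((η : ℂ))⁻¹‖ ^ 2 * δ) * ‖f‖ ^ 2) ≤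
        RCLike.re ⟪f, curvOp φ τ η U f⟫_ℂ :=
    fun f => re_inner_curvOp_self_ge φ hφ hstar τ hτ hMτ η U (fun b => B7Prop1Explicit.mem_U1.mp (hU b)) hδ hRe hIm f
  have hCQ0 : 0 ≤ Mφ' * Mφ * Real.sqrt (c₁ / (c₀ * ((L : ℝ) ^ (n + 1)) ^ d)) *
      Real.exp (Real.sqrt ((L : ℝ) ^ d) * (Real.sqrt (2 * d) * (102 * (d + 1) ^ 2 * L)) * (εs / (1 - ϱ))) := by positivity
  exact norm_block_H1k_le φ hφ hφ' hMφ hMφ' hη hηL U hU hRS τ hL α hα1 hU1 hreg a hαL ha hm hpos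
    (QkW_surjective L m n φ U hL α hα1 hU1 hreg (c₀ := c₀) (c₁ := c₁) hαL)
    hγ hγ1 hβ hβ1 hβK0 hℓ hℓ' hr hρ0 hρ8 (by positivity) hCQ0 hμ₁ hcoer hX1 hKre
    (norm_QkW_le_of_geometric_window L m n hL φ hMφ hMφ' hφ hφ' U α hα1 hU1 hreg εU hεU hUε hϱ0 hϱ1 hεs hεg (c₀ := c₀) (c₁ := c₁))
    hwin hβCC hβC hβD
    (hQK_of_chain_tower L m n φ hφ hφ' hMφ hMφ' hstar hη U hU hRS τ hτ hMτ hL hm α hα1 hU1 hreg εU hεU hUε hδ hRe hIm ha' hpos' hγ' hγ'1 hκ₁ hM coercive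
      hκ hMQ hℓ hℓ' hβ'0 hβ'1 hwin hwin0 hwin1 hwin' hβT hβK hβ'D hβ'Q small' hwinκ hρ)
    (B9Eq325ProjectionDivergenceQuarterKappaTower.norm_one_sub_RofUk_covDivL2K_le_sqrt L m n φ c₀ η U c₁ a' hRS hpos' ha' hM hκ₁ hMQ hκ)
    small small2 PB hPB hrF (by positivity) hr' hr'r
    (fun z z' => norm_block_adjoint_QkW_le_of_geometric_window L m n φ U hL α hα1 hU1 hreg hφ hφ' hMφ hMφ' hPB hrF εU hεU hUε hϱ0 hϱ1 hεs hεg hm hα0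
      hr z z')
    y₀ y₁

end Literature.MathematicalPhysics.QuantumFieldTheory.Balaban1983to89.B9Eq3126H1BlockDecayTowerClosed

end
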